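import Summits.RiemannHypothesis.RiemannHypothesis.Theorems.GroundBartaEvenWinsBeyondArchDeflationCertLeak
import HarnessLib

/-!
# RiemannHypothesis / GroundBarta — rung 4 (`EvenWinsBeyondArch`, stmt-RiemannHypothesis-18807 / 18085):
# the LEAKY CERTIFICATE for APPROXIMATE trial vectors (penalties and trial vectors in different formats)

Helper file (`--supports stmt-RiemannHypothesis-18085`), RH-free, no definitions, no named facts.  Prover B (gen 6 of
unit `sr-gb-rung-b`).

`dt_cert_leak` (…CertLeak) lets the trial vectors be the certificate's penalty polynomials CUT at `c' < c`.  In the endpoint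
cell the three engines cannot even share the polynomials: the two-prime certificate needs its penalties
`p_r(x) = Σ_k ĉ_k (x/a₀)^k` scaled by its support radius `a₀ ≥ (log 5)/2`, while the A-layer / R-layer engines need the trial
vectors as `𝟙_{[-c',c']}·P(x/c')` scaled by the CUT `c' < (log 5)/2`, each with short dyadic coefficients — and no polynomial
has short coefficients in both scalings.  The leak absorbs the difference: for ANY profiles `g_r` with
`v_r = 𝟙_{[-c',c']} g_r`,

  `(β − 2ν)‖φ‖² ≤ E₂₃(φ) + Σ_r 2μ_r |⟨φ, v_r⟩|²`,  `ν ≥ Σ_r μ_r (∫_{[-c',c']} (p_r − g_r)² + ∫_{[-a₀,a₀]∖[-c',c']} p_r²)`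

(`dt_cert_leak_approx`) — in the application `g_r` is a dyadic rounding of `p_r` re-expanded in `x/c'` (first integral
`≈ 10⁻³⁸`) and the second integral is the shell leak.

* `dt_integral_norm_sq_indicator_sub_approx` — `∫‖𝟙_{[-c,c]}p − 𝟙_{[-c',c']}g‖² = ∫_{[-c',c']}(p−g)² + ∫_{[-c,c]∖[-c',c']} p²`;
* **`dt_cert_leak_approx`**.
-/

set_option linter.dupNamespace false

noncomputable section

open MeasureTheory Set Filter
open scoped Topology ComplexConjugate BigOperators

namespace Summit.RiemannHypothesis.RiemannHypothesis.Theorems.EvenWinsBeyondArch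

open Literature.NumberTheory.LFunctions Literature.NumberTheory.LFunctions.ConnesVanSuijlekom
open Summit.RiemannHypothesis.RiemannHypothesis.Theorems.GroundStateSimpleEven (incs_memLp)

/-- **The mismatch of a cut approximate profile**: for `c' ≤ c` and continuous real `p, g`,
`∫‖𝟙_{[-c,c]}p − 𝟙_{[-c',c']}g‖² = ∫_{[-c',c']} (p − g)² + ∫_{[-c,c] ∖ [-c',c']} p²`. [folklore] -/
theorem dt_integral_norm_sq_indicator_sub_approx {c c' : ℝ} (hcc : c' ≤ c) {p g : ℝ → ℝ} (hp : Continuous p)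
    (hg : Continuous g) :
    ∫ x, ‖(((Icc (-c) c).indicator p x : ℝ) : ℂ) - (((Icc (-c') c').indicator g x : ℝ) : ℂ)‖ ^ 2 =
      (∫ x in Icc (-c') c', (p x - g x) ^ 2) + ∫ x in Icc (-c) c \ Icc (-c') c', p x ^ 2 := by
  have hsub : Icc (-c') c' ⊆ Icc (-c) c := Icc_subset_Icc (by linarith) hcc
  have hpt : ∀ x, ‖(((Icc (-c) c).indicator p x : ℝ) : ℂ) - (((Icc (-c') c').indicator g x : ℝ) : ℂ)‖ ^ 2 =
      (Icc (-c') c').indicator (fun x ↦ (p x - g x) ^ 2) x + (Icc (-c) c \ Icc (-c') c').indicator (fun x ↦ p x ^ 2) x := by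
    intro x
    by_cases hx' : x ∈ Icc (-c') c'
    · rw [indicator_of_mem (hsub hx'), indicator_of_mem hx', indicator_of_mem hx',
        indicator_of_notMem (fun h ↦ h.2 hx')]
      rw [add_zero, ← Complex.ofReal_sub, Complex.norm_real, Real.norm_eq_abs, sq_abs]
    · by_cases hx : x ∈ Icc (-c) c
      · rw [indicator_of_mem hx, indicator_of_notMem hx', indicator_of_notMem hx',
          indicator_of_mem (mem_sdiff_of_mem hx hx')]
        push_cast
        rw [sub_zero, zero_add, Complex.norm_real, Real.norm_eq_abs, sq_abs]
      · rw [indicator_of_notMem hx, indicator_of_notMem hx', indicator_of_notMem hx',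
          indicator_of_notMem (fun h ↦ hx h.1)]
        simp
  simp_rw [hpt]
  have i1 : Integrable ((Icc (-c') c').indicator fun x ↦ (p x - g x) ^ 2) :=
    (((hp.sub hg).pow 2).continuousOn.integrableOn_Icc).integrable_indicator measurableSet_Icc
  have i2 : Integrable ((Icc (-c) c \ Icc (-c') c').indicator fun x ↦ p x ^ 2) :=
    (((hp.pow 2).continuousOn.integrableOn_Icc).mono_set sdiff_subset).integrable_indicator
      (measurableSet_Icc.diff measurableSet_Icc)
  rw [integral_add i1 i2, integral_indicator measurableSet_Icc,
    integral_indicator (measurableSet_Icc.diff measurableSet_Icc)]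

/-- **The leaky certificate for approximate cut trial vectors.**  As `dt_cert_leak`, but the trial vectors are
`v_r = 𝟙_{[-c',c']}·g_r` for ARBITRARY continuous profiles `g_r`; the leak `ν` bounds
`Σ_r μ_r (∫_{[-c',c']}(p_r − g_r)² + ∫_{[-a₀,a₀]∖[-c',c']} p_r²)` with `p_r = maskPoly R_r n a₀`.  Conclusion:
`(β − 2ν)‖φ‖² ≤ E + Σ_r 2μ_r |∫ φ v̄_r|²` for every test `φ` of `[-c, c]`, `c' ≤ c ≤ a₀`, satisfying the certificate
inequality `β‖φ‖² ≤ E + Σ_r μ_r|Σ_k ĉ_{rk}M_k(φ)|²`. [folklore] -/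
theorem dt_cert_leak_approx (R : List (ℚ × ℕ × List ℚ)) (n : ℕ) {a₀ c c' : ℝ} (hcc : c' ≤ c) (hca : c ≤ a₀)
    (hRμ : ∀ i : Fin R.length, 0 ≤ (R.get i).1)
    {φ : ℝ → ℂ} (hφ : IsWeilTest φ) (hφs : tsupport φ ⊆ Icc (-c) c) {β E : ℝ}
    (h23 : β * weilNorm2Sq φ ≤ E +
      (R.map fun r ↦ (r.1 : ℝ) * ‖∑ k ∈ Finset.range n, ((maskV r k : ℚ) : ℂ) * weilMoment a₀ φ k‖ ^ 2).sum)
    (g : Fin R.length → ℝ → ℝ) (hg : ∀ i, Continuous (g i)) (v : Fin R.length → ℝ → ℂ)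
    (hv : ∀ i x, v i x = (((Icc (-c') c').indicator (g i) x : ℝ) : ℂ))
    {ν : ℝ} (hν : ∑ i : Fin R.length, ((R.get i).1 : ℝ) *
      ((∫ x in Icc (-c') c', (maskPoly (R.get i) n a₀ x - g i x) ^ 2) +
        ∫ x in Icc (-a₀) a₀ \ Icc (-c') c', (maskPoly (R.get i) n a₀ x) ^ 2) ≤ ν) :
    (β - 2 * ν) * ∫ x, ‖φ x‖ ^ 2 ≤
      E + ∑ i : Fin R.length, (2 * ((R.get i).1 : ℝ)) * ‖∫ x, φ x * conj (v i x)‖ ^ 2 := by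
  -- the full-window vectors `u_i = 𝟙_{[-c,c]} p_i`
  set u : Fin R.length → ℝ → ℂ := fun i x ↦
    (((Icc (-c) c).indicator (fun x ↦ maskPoly (R.get i) n a₀ x) x : ℝ) : ℂ) with hu
  have hpc : ∀ i, Continuous fun x ↦ maskPoly (R.get i) n a₀ x := fun i ↦
    (contDiff_maskPoly (R.get i) n a₀ (m := 0)).continuous
  have huM : ∀ i, MemLp (u i) 2 := fun i ↦ incs_memLp (hpc i) c
  have hvM : ∀ i, MemLp (v i) 2 := fun i ↦ by
    have e : v i = fun x ↦ (((Icc (-c') c').indicator (g i) x : ℝ) : ℂ) := funext (hv i)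
    rw [e]; exact incs_memLp (hg i) c'
  have hφM : MemLp φ 2 := hφ.memLp_two
  have hN : weilNorm2Sq φ = ∫ x, ‖φ x‖ ^ 2 := rfl
  have hN0 : 0 ≤ ∫ x, ‖φ x‖ ^ 2 := integral_nonneg fun _ ↦ by positivity
  -- the certificate's rank-one terms as pairings with the `u_i`
  have hsum : (R.map fun r ↦ (r.1 : ℝ) * ‖∑ k ∈ Finset.range n, ((maskV r k : ℚ) : ℂ) * weilMoment a₀ φ k‖ ^ 2).sum =
      ∑ i : Fin R.length, ((R.get i).1 : ℝ) * ‖∫ x, φ x * conj (u i x)‖ ^ 2 := by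
    rw [dt_list_sum_map_eq_sum_get]
    refine Finset.sum_congr rfl fun i _ ↦ ?_
    rw [dt_rankOne_term_eq (R.get i) n a₀ hφ hφs]
  -- abbreviation for the mismatch of vector `i` at the radius `a₀`
  set η : Fin R.length → ℝ := fun i ↦ (∫ x in Icc (-c') c', (maskPoly (R.get i) n a₀ x - g i x) ^ 2) +
    ∫ x in Icc (-a₀) a₀ \ Icc (-c') c', (maskPoly (R.get i) n a₀ x) ^ 2 with hη
  -- the leak of one term: `‖⟨φ,u_i⟩‖² ≤ 2‖⟨φ,v_i⟩‖² + 2‖φ‖² η_i`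
  have hleak : ∀ i, ‖∫ x, φ x * conj (u i x)‖ ^ 2 ≤
      2 * ‖∫ x, φ x * conj (v i x)‖ ^ 2 + 2 * ((∫ x, ‖φ x‖ ^ 2) * η i) := by
    intro i
    have hcs := norm_integral_mul_conj_sub_le hφM (huM i) (hvM i)
    have hdiff : ∫ x, ‖u i x - v i x‖ ^ 2 = (∫ x in Icc (-c') c', (maskPoly (R.get i) n a₀ x - g i x) ^ 2) +
        ∫ x in Icc (-c) c \ Icc (-c') c', (maskPoly (R.get i) n a₀ x) ^ 2 := by
      simp only [hu, hv i]
      exact dt_integral_norm_sq_indicator_sub_approx hcc (hpc i) (hg i)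
    have hpint : IntegrableOn (fun x ↦ (maskPoly (R.get i) n a₀ x) ^ 2) (Icc (-a₀) a₀) :=
      ((hpc i).pow 2).continuousOn.integrableOn_Icc
    have hmono : ∫ x in Icc (-c) c \ Icc (-c') c', (maskPoly (R.get i) n a₀ x) ^ 2 ≤
        ∫ x in Icc (-a₀) a₀ \ Icc (-c') c', (maskPoly (R.get i) n a₀ x) ^ 2 :=
      setIntegral_mono_set (hpint.mono_set sdiff_subset)
        (Eventually.of_forall fun x ↦ sq_nonneg _)
        (Eventually.of_forall (sdiff_subset_sdiff_left (Icc_subset_Icc (by linarith) hca)))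
    have hle : ∫ x, ‖u i x - v i x‖ ^ 2 ≤ η i := by rw [hdiff, hη]; linarith
    have h0 : 0 ≤ ∫ x, ‖u i x - v i x‖ ^ 2 := integral_nonneg fun _ ↦ by positivity
    set A : ℂ := ∫ x, φ x * conj (v i x) with hA
    set B : ℂ := (∫ x, φ x * conj (u i x)) - ∫ x, φ x * conj (v i x) with hB
    have hAB : ∫ x, φ x * conj (u i x) = A + B := by rw [hA, hB]; ring
    have hB2 : ‖B‖ ^ 2 ≤ (∫ x, ‖φ x‖ ^ 2) * ∫ x, ‖u i x - v i x‖ ^ 2 := by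
      have h1 : ‖B‖ ≤ √(∫ x, ‖φ x‖ ^ 2) * √(∫ x, ‖u i x - v i x‖ ^ 2) := hcs
      calc ‖B‖ ^ 2 ≤ (√(∫ x, ‖φ x‖ ^ 2) * √(∫ x, ‖u i x - v i x‖ ^ 2)) ^ 2 :=
            pow_le_pow_left₀ (norm_nonneg _) h1 2
        _ = (∫ x, ‖φ x‖ ^ 2) * ∫ x, ‖u i x - v i x‖ ^ 2 := by
            rw [mul_pow, Real.sq_sqrt hN0, Real.sq_sqrt h0]
    rw [hAB]
    have h3 : ‖A + B‖ ^ 2 ≤ 2 * ‖A‖ ^ 2 + 2 * ‖B‖ ^ 2 := by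
      have h := norm_add_le A B
      nlinarith [norm_nonneg (A + B), norm_nonneg A, norm_nonneg B, sq_nonneg (‖A‖ - ‖B‖)]
    nlinarith [mul_le_mul_of_nonneg_left hle hN0]
  -- sum the leaks
  have hpen : ∑ i : Fin R.length, ((R.get i).1 : ℝ) * ‖∫ x, φ x * conj (u i x)‖ ^ 2 ≤
      (∑ i : Fin R.length, (2 * ((R.get i).1 : ℝ)) * ‖∫ x, φ x * conj (v i x)‖ ^ 2) +
        2 * (∫ x, ‖φ x‖ ^ 2) * ∑ i : Fin R.length, ((R.get i).1 : ℝ) * η i := by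
    rw [Finset.mul_sum, ← Finset.sum_add_distrib]
    refine Finset.sum_le_sum fun i _ ↦ ?_
    have hμ : 0 ≤ ((R.get i).1 : ℝ) := by exact_mod_cast hRμ i
    have h := mul_le_mul_of_nonneg_left (hleak i) hμ
    linarith
  have hη0 : ∀ i, 0 ≤ η i := fun i ↦ add_nonneg
    (setIntegral_nonneg measurableSet_Icc fun x _ ↦ sq_nonneg _)
    (setIntegral_nonneg (measurableSet_Icc.diff measurableSet_Icc) fun x _ ↦ sq_nonneg _)
  have hS0 : 0 ≤ ∑ i : Fin R.length, ((R.get i).1 : ℝ) * η i :=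
    Finset.sum_nonneg fun i _ ↦ mul_nonneg (by exact_mod_cast hRμ i) (hη0 i)
  rw [hsum, hN] at h23
  have hν' : ∑ i : Fin R.length, ((R.get i).1 : ℝ) * η i ≤ ν := by simpa only [hη] using hν
  have hνN := mul_le_mul_of_nonneg_left hν' hN0
  nlinarith [hpen, hνN, hS0]

end Summit.RiemannHypothesis.RiemannHypothesis.Theorems.EvenWinsBeyondArch

end
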